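import Literature.NumberTheory.Transcendental.ManyCurveThetaClassification
import HarnessLib

/-!
# Periods of two non-isogenous elliptic curves — the named fact `HuberWustholzTwoCurvePeriods` DISCHARGED

Topic `Literature/NumberTheory/Transcendental`; a proofs-only companion (one theorem: no
definitions, no named facts) of `TwoCurvePeriods.lean`, whose named fact
`HuberWustholzTwoCurvePeriods` (A. Huber, G. Wüstholz, *Transcendence and Linear Relations of
1-Periods*, Cambridge Tracts in Mathematics 227, CUP 2022, **Theorem 15.3 (1)** (p. 145) for the
1-motive `M = [ℤ →⁰ 𝔾ₘ] × E × E'` with `E, E'` non-CM and non-isogenous, `δ(M) = 10`, read with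
Prop. 18.8: the ten 1-periods `1, 2πi, ω₁, ω₂, η₁, η₂, ω₁', ω₂', η₁', η₂'` are linearly independent
over `ℚ̄`) is proved here outright.

The proof is the `k = 2` instance of the `k`-curve theorem `HuberWustholzManyCurvePeriods`
(`ManyCurvePeriods.lean`; Thm. 15.3 (1) for `[ℤ →⁰ 𝔾ₘ] × E₁ × ⋯ × E_k`, pairwise non-isogenous
curves, CM allowed), which is a theorem of the tree:
`HuberWustholzManyCurvePeriods_holds` (`ManyCurveThetaClassification.lean`: reduction to the
Baker–Wüstholz analytic subgroup theorem for the `k`-lattice standard models of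
`𝔾ₐ × 𝔾ₘ^ι × ∏ E♮` at torsion points and Philippon's zero estimate for their theta models, all
formalized in the `ManyCurve*` files). The specialisation to two non-CM lattices — regrouping the
ten-term combination into the block form of the `k`-curve statement and using the symmetry of
isogeny (`PeriodPair.IsIsogenousTo.symm`) to pass from the one-sided hypothesis
`¬ Λ ~ Λ'` to pairwise non-isogeny — is the proved corollary
`HuberWustholzManyCurvePeriods.twoCurvePeriods` of `ManyCurvePeriods.lean`.

This file is a leaf: `TwoCurvePeriods.lean` keeps its light imports, and users of
`(h : HuberWustholzTwoCurvePeriods)` are fed `HuberWustholzTwoCurvePeriods_holds` from here.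

## References

* A. Huber, G. Wüstholz, *Transcendence and Linear Relations of 1-Periods*, Cambridge Tracts in
  Mathematics 227, CUP 2022 [HuberWustholz2022]: Thm. 15.3 (1), (3) (p. 145); §15.2.2,
  Lemma 15.8 / Prop. 15.9 (pp. 149–150: simple pairwise non-isogenous factors); Prop. 18.8
  (periods of `h¹(E)` are `ωᵢ, ηᵢ`).
* A. Baker, G. Wüstholz, *Logarithmic Forms and Diophantine Geometry*, New Mathematical
  Monographs 9, CUP 2007 [BakerWustholz2007]: Thm. 6.4 (p. 98), Thm. 6.15.
* P. Philippon, *Lemmes de zéros dans les groupes algébriques commutatifs*, Bull. Soc. Math.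
  France 114 (1986), 355–383, Thm. 2.1. [Philippon1986]
-/

noncomputable section

namespace Literature.NumberTheory.Transcendental

/-- **DISCHARGE of the named fact `HuberWustholzTwoCurvePeriods`** (Huber–Wüstholz, Cambridge
Tract 227, Thm. 15.3 (1) for `M = [ℤ →⁰ 𝔾ₘ] × E × E'`, `E, E'` non-CM, non-isogenous, with
algebraic invariants: `1, 2πi, ω₁, ω₂, η₁, η₂, ω₁', ω₂', η₁', η₂'` are `ℚ̄`-linearly independent):
the case `k = 2` of the proved `k`-curve theorem `HuberWustholzManyCurvePeriods_holds`, via the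
proved specialisation `HuberWustholzManyCurvePeriods.twoCurvePeriods`.
[cite: HuberWustholz2022, Thm. 15.3 (1) (p. 145) with Prop. 18.8] -/
theorem HuberWustholzTwoCurvePeriods_holds : HuberWustholzTwoCurvePeriods :=
  HuberWustholzManyCurvePeriods_holds.twoCurvePeriods

end Literature.NumberTheory.Transcendental

end
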